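import Summits.ResolutionOfSingularities.ResolutionOfSingularities.Theorems.HilbertSamuelEliminationSigmaMaxModificationsCorridor3WLadderIsoTailsBaseChangeHSFunGlobal
import Summits.ResolutionOfSingularities.ResolutionOfSingularities.Theorems.HilbertSamuelEliminationSigmaMaxModificationsCorridor3WLadderIsoTailsSeparableBaseChangeLocalDim
import Literature.AlgebraicGeometry.Motives.VarietiesDimensionProofs
import HarnessLib

/-!
# [OURS · L1 W4.2] K2-sep ROUTE A, brick (δ2 d): **`dim 𝒪_{X ×_k K, x′} = dim 𝒪_{X, pr₁ x′}` at every point and `dim (X ×_k K) ≤ dim X`**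
# for `X → Spec k` locally of finite type and `K/k` separable algebraic (affine charts + (β5) `ringKrullDim_localization_tensorProduct_eq`;
# GW Lemma 5.7 (4) `dim X = sup_x dim 𝒪_{X,x}`, tree `Scheme.topologicalKrullDim_eq_iSup_ringKrullDim_stalk`)
# (crux `SigmaMaxModifications` stmt-ResolutionOfSingularities-18506 / conjunct stmt-…-19249; line `w_ladder_rows` v8.5, registered stub
# `stub_isoSepRecurrent`; res-L1-w42-plan-1 WORD 2026-08-27T16:25:47Z; design `L/res-L1-w42-stub-2/k2sep/K2SEP-DESIGN.md` §8 (δ2)(d))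

Prover res-L1-w42-stub-2 (gen 5). Helper file `--supports stmt-ResolutionOfSingularities-19249 --as helper`; no definitions, no named fact. OURS
(cell res-hironaka, slot W4.2); NOT statements of [Hironaka2017] nor of [CossartJannsenSaito2020]. AI-written; AI review is weaker than expert
review. This is the input `hdim : dim X_K ≤ N` of (β3) `isMaximalOrigin_of_hsFun_eq`.

* `ringKrullDim_stalk_Spec_eq` — `dim 𝒪_{Spec A, 𝔮} = dim A_𝔮`.
* `ringKrullDim_stalk_pullback_SpecMap_eq_of_chart`, **`ringKrullDim_stalk_pullback_SpecMap_eq`** — `dim 𝒪_{X ×_k K, x′} = dim 𝒪_{X, pr₁ x′}`.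
* **`topologicalKrullDim_pullback_SpecMap_le`** — `dim (X ×_k K) ≤ dim X`.

[OURS · L1 W4.2; AI-written] [cite: GortzWedhorn2020, Lemma 5.7 (4), Prop. 5.38] [cite: Matsumura1987, Thm. 15.1]
-/

set_option linter.dupNamespace false

noncomputable section

open scoped TensorProduct
open CategoryTheory CategoryTheory.Limits AlgebraicGeometry IsLocalRing
open Literature.RingTheory.HilbertSamuel Literature.AlgebraicGeometry.Resolution

namespace Summit.ResolutionOfSingularities.ResolutionOfSingularities.Theorems.SigmaMaxModificationsCorridor3.IsoTailsHS

universe u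

/-- `dim 𝒪_{Spec A, 𝔮} = dim A_𝔮` (`𝒪_{Spec A,𝔮}` is a localization of `A` at `𝔮`). [folklore] -/
theorem ringKrullDim_stalk_Spec_eq {A : Type u} [CommRing A] (x : ↥(Spec (CommRingCat.of A))) :
    ringKrullDim ((Spec (CommRingCat.of A)).presheaf.stalk x) = ringKrullDim (Localization.AtPrime x.asIdeal) := by
  letI : Algebra A ((Spec (.of A)).presheaf.stalk x) := (StructureSheaf.toStalk A x).hom.toAlgebra
  haveI : IsLocalization.AtPrime ((Spec (.of A)).presheaf.stalk x) x.asIdeal := StructureSheaf.IsLocalization.to_stalk A x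
  exact ringKrullDim_eq_of_ringEquiv
    (IsLocalization.algEquiv x.asIdeal.primeCompl ((Spec (.of A)).presheaf.stalk x) (Localization.AtPrime x.asIdeal)).toRingEquiv

/-- `dim` of local rings is invariant along a morphism inducing an isomorphism of stalks (open immersions, isomorphisms). [folklore] -/
theorem ringKrullDim_stalk_eq_of_isIso_stalkMap {X Y : Scheme.{u}} (f : X ⟶ Y) (x : X) [IsIso (f.stalkMap x)] :
    ringKrullDim (X.presheaf.stalk x) = ringKrullDim (Y.presheaf.stalk (f.base x)) :=
  (ringKrullDim_eq_of_ringEquiv (asIso (f.stalkMap x)).commRingCatIsoToRingEquiv).symm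

set_option maxHeartbeats 800000 in
-- pullback bookkeeping over an affine chart (as in `hsFun_pullback_SpecMap_algebraMap_eq_of_chart`)
/-- **`dim 𝒪_{X ×_k K, x′} = dim 𝒪_{X, pr₁ x′}` on a given affine chart** (the chart argument of `hsFun_pullback_SpecMap_algebraMap_eq_of_chart`
with (β5) `ringKrullDim_localization_tensorProduct_eq` in place of the `H`-statement). [cite: Matsumura1987, Thm. 15.1] -/
theorem ringKrullDim_stalk_pullback_SpecMap_eq_of_chart {k K : Type u} [Field k] [Field K] [Algebra k K] [Algebra.IsSeparable k K]
    {X : Scheme.{u}} (f : X ⟶ Spec (CommRingCat.of k))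
    (x' : ↥(pullback f (Spec.map (CommRingCat.ofHom (algebraMap k K)))))
    {R : CommRingCat.{u}} (c : Spec R ⟶ X) [IsOpenImmersion c] [LocallyOfFiniteType (c ≫ f)] (y : ↥(Spec R))
    (hy : c.base y = (pullback.fst f (Spec.map (CommRingCat.ofHom (algebraMap k K)))).base x') :
    ringKrullDim ((pullback f (Spec.map (CommRingCat.ofHom (algebraMap k K)))).presheaf.stalk x') =
      ringKrullDim (X.presheaf.stalk ((pullback.fst f (Spec.map (CommRingCat.ofHom (algebraMap k K)))).base x')) := by
  obtain ⟨ψ, hψ⟩ : ∃ ψ : CommRingCat.of k ⟶ R, Spec.map ψ = c ≫ f := ⟨Spec.preimage (c ≫ f), Spec.map_preimage _⟩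
  letI : Algebra k R := ψ.hom.toAlgebra
  have hψ' : CommRingCat.ofHom (algebraMap k R) = ψ := rfl
  haveI : LocallyOfFiniteType (Spec.map ψ) := by rw [hψ]; infer_instance
  haveI : Algebra.FiniteType k R :=
    (HasRingHomProperty.Spec_iff (P := @LocallyOfFiniteType)).mp (inferInstance : LocallyOfFiniteType (Spec.map ψ))
  haveI : IsNoetherianRing R := Algebra.FiniteType.isNoetherianRing k R
  haveI : IsNoetherianRing (R ⊗[k] K) := by
    letI : Algebra K (R ⊗[k] K) := Algebra.TensorProduct.rightAlgebra
    haveI : Algebra.FiniteType K (R ⊗[k] K) := finiteType_tensorProduct_right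
    exact Algebra.FiniteType.isNoetherianRing K (R ⊗[k] K)
  have e₁ : Spec.map (CommRingCat.ofHom (algebraMap k R)) ≫ 𝟙 (Spec (CommRingCat.of k)) = c ≫ f := by
    rw [Category.comp_id, hψ', hψ]
  have e₂ : Spec.map (CommRingCat.ofHom (algebraMap k K)) ≫ 𝟙 (Spec (CommRingCat.of k)) =
      𝟙 _ ≫ Spec.map (CommRingCat.ofHom (algebraMap k K)) := by rw [Category.comp_id, Category.id_comp]
  haveI : IsOpenImmersion (pullback.map (Spec.map (CommRingCat.ofHom (algebraMap k R))) (Spec.map (CommRingCat.ofHom (algebraMap k K)))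
      f (Spec.map (CommRingCat.ofHom (algebraMap k K))) c (𝟙 _) (𝟙 _) e₁ e₂) := inferInstance
  have hx'mem : x' ∈ Set.range (pullback.map (Spec.map (CommRingCat.ofHom (algebraMap k R)))
      (Spec.map (CommRingCat.ofHom (algebraMap k K))) f (Spec.map (CommRingCat.ofHom (algebraMap k K))) c (𝟙 _) (𝟙 _) e₁ e₂).base := by
    have hr := Scheme.Pullback.range_map (Spec.map (CommRingCat.ofHom (algebraMap k R)))
      (Spec.map (CommRingCat.ofHom (algebraMap k K))) f (Spec.map (CommRingCat.ofHom (algebraMap k K))) c (𝟙 _) (𝟙 _) e₁ e₂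
    change x' ∈ Set.range ⇑(ConcreteCategory.hom (pullback.map _ _ _ _ _ _ _ e₁ e₂).base)
    rw [hr]
    refine ⟨⟨y, hy⟩, ?_⟩
    show (pullback.snd f _).base x' ∈ Set.range (𝟙 (Spec (CommRingCat.of K)) : Spec _ ⟶ Spec _).base
    exact ⟨(pullback.snd f (Spec.map (CommRingCat.ofHom (algebraMap k K)))).base x', by simp⟩
  obtain ⟨y', hy'⟩ := hx'mem
  -- (1) along the open immersion into `X ×_k K`; (2) along the iso with `Spec (R ⊗ K)`
  rw [← hy', ← ringKrullDim_stalk_eq_of_isIso_stalkMap (pullback.map _ _ _ _ _ _ _ e₁ e₂) y',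
    ringKrullDim_stalk_eq_of_isIso_stalkMap (pullbackSpecIso k R K).hom y']
  -- (3) the affine statement
  rw [ringKrullDim_stalk_Spec_eq, ringKrullDim_localization_tensorProduct_eq (k := k) (A := R) ((pullbackSpecIso k R K).hom.base y').asIdeal,
    ← ringKrullDim_stalk_Spec_eq (⟨((pullbackSpecIso k R K).hom.base y').asIdeal.under R,
      Ideal.IsPrime.under R ((pullbackSpecIso k R K).hom.base y').asIdeal⟩ : ↥(Spec (CommRingCat.of R)))]
  -- (4) back to `X` along the chart
  have hpt : (⟨((pullbackSpecIso k R K).hom.base y').asIdeal.under R,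
        Ideal.IsPrime.under R ((pullbackSpecIso k R K).hom.base y').asIdeal⟩ : ↥(Spec R)) =
      (pullback.fst (Spec.map (CommRingCat.ofHom (algebraMap k R))) (Spec.map (CommRingCat.ofHom (algebraMap k K)))).base y' := by
    have h := pullbackSpecIso_hom_fst' k R K
    rw [← h, Scheme.Hom.comp_apply]
    rfl
  change ringKrullDim ((Spec R).presheaf.stalk _) = _
  rw [ringKrullDim_stalk_eq_of_isIso_stalkMap c, hpt]
  have hcomm : pullback.fst (Spec.map (CommRingCat.ofHom (algebraMap k R))) (Spec.map (CommRingCat.ofHom (algebraMap k K))) ≫ c =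
      pullback.map _ _ _ _ _ _ _ e₁ e₂ ≫ pullback.fst f (Spec.map (CommRingCat.ofHom (algebraMap k K))) := by
    simp only [pullback.lift_fst, pullback.map]
  have hq : c.base ((pullback.fst (Spec.map (CommRingCat.ofHom (algebraMap k R))) (Spec.map (CommRingCat.ofHom (algebraMap k K)))).base y') =
      (pullback.fst f (Spec.map (CommRingCat.ofHom (algebraMap k K)))).base ((pullback.map _ _ _ _ _ _ _ e₁ e₂).base y') := by
    rw [← Scheme.Hom.comp_apply, hcomm, Scheme.Hom.comp_apply]
  rw [hq]

/-- **`dim 𝒪_{X ×_k K, x′} = dim 𝒪_{X, pr₁ x′}` at every point** (`f` locally of finite type, `K/k` separable algebraic).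
[cite: Matsumura1987, Thm. 15.1] -/
theorem ringKrullDim_stalk_pullback_SpecMap_eq {k K : Type u} [Field k] [Field K] [Algebra k K] [Algebra.IsSeparable k K]
    {X : Scheme.{u}} (f : X ⟶ Spec (CommRingCat.of k)) [LocallyOfFiniteType f]
    (x' : ↥(pullback f (Spec.map (CommRingCat.ofHom (algebraMap k K))))) :
    ringKrullDim ((pullback f (Spec.map (CommRingCat.ofHom (algebraMap k K)))).presheaf.stalk x') =
      ringKrullDim (X.presheaf.stalk ((pullback.fst f (Spec.map (CommRingCat.ofHom (algebraMap k K)))).base x')) := by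
  obtain ⟨y, hy⟩ := X.affineOpenCover.covers ((pullback.fst f (Spec.map (CommRingCat.ofHom (algebraMap k K)))).base x')
  exact ringKrullDim_stalk_pullback_SpecMap_eq_of_chart f x' (X.affineOpenCover.f _) y hy

/-- **`dim (X ×_k K) ≤ dim X`** (`f` locally of finite type, `K/k` separable algebraic): `dim = sup` of the dimensions of the local rings
(GW Lemma 5.7 (4)) and these agree along `pr₁`. [cite: GortzWedhorn2020, Lemma 5.7 (4), Prop. 5.38] -/
theorem topologicalKrullDim_pullback_SpecMap_le {k K : Type u} [Field k] [Field K] [Algebra k K] [Algebra.IsSeparable k K]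
    {X : Scheme.{u}} (f : X ⟶ Spec (CommRingCat.of k)) [LocallyOfFiniteType f] :
    topologicalKrullDim ↥(pullback f (Spec.map (CommRingCat.ofHom (algebraMap k K)))) ≤ topologicalKrullDim ↥X := by
  rw [Literature.AlgebraicGeometry.Motives.Scheme.topologicalKrullDim_eq_iSup_ringKrullDim_stalk,
    Literature.AlgebraicGeometry.Motives.Scheme.topologicalKrullDim_eq_iSup_ringKrullDim_stalk]
  refine iSup_le fun x' => ?_
  rw [ringKrullDim_stalk_pullback_SpecMap_eq f x']
  exact le_iSup (fun x : ↥X => ringKrullDim (X.presheaf.stalk x)) _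

end Summit.ResolutionOfSingularities.ResolutionOfSingularities.Theorems.SigmaMaxModificationsCorridor3.IsoTailsHS

end
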